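import Mathlib
import HarnessLib
import Literature.MathematicalPhysics.StatisticalMechanics.AbkmPackageSlots
import Literature.MathematicalPhysics.StatisticalMechanics.LastScaleKernelParaSecondDiffTorusFRD

/-!
# The slot `F4Φ22` of `AbkmPackageSlots` HOLDS with an `N`-free size: the `ℓ = 2` last-scale half of
# `L2GaussianCore` ([ABKM19] Lemma 8.4 / Lemma 12.6 with `ℓ = 2`, last scale)

`AbkmPackageSlots.F4Φ22 P Q φTT` asks, for the package `P` at height `N` (`Q`), for mixed second differences
of the last-scale functional `q ↦ Φ_q(y) = ∫ y(Λ_N) dμ_{𝒞_{1+q,N+1}}` on parallelograms in the tuning ball: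
`‖Φ_{q+y+z} − Φ_{q+y} − Φ_{q+z} + Φ_q‖ ≤ φ_TT |y|₁ |z|₁ c`.  This file DISCHARGES it from
`norm_integral_last_kernel_paraSecondDiff_le_of_torusFRD` with the explicit size

* the size `4 A⁻¹ (r₀+1) κ d⁴ (108 q_H² 3^{d+1} e^{4K} K² + 8 q_H 3^{(d+1)/2} max(K⁽²⁾,0))` with the Hölder
  data `ρ'' = (θ+θ̄)/2`, `p = (1+ρ'')/(1+θ)`, `q_H = p/(p−1)`, `κ = A𝒫(ρ'')^{1/p}` — which depends on `P` ONLY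
  (not on `N`; the `max` only records `K⁽²⁾ ≥ 0`, true at every height but not a field of `PackageData`);
* `cl_nonneg_of_packageAt` — `0 ≤ Cℓ ℓ` (`ℓ ≥ 1`) is a consequence of clause (v) (zero direction), needed by
  the first-order half and not recorded in `PackageData`;
* **`f4Φ22_of_packageAt`** — `F4Φ22 P Q (size)` for every `N, M, Q`; hence
  **`exists_f4Φ22_unif`** — `∀ P, ∃ φTT ≥ 0, ∀ N M Q, F4Φ22 P Q φTT` (the `F4Φ22` half of `L2GaussianCore`).

Everything is proved; no named fact.  Honest scope: a `q`-regularity slot of the rung route (complex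
Gaussian gradient-field stiffness), nothing about superconductivity in the Hubbard model.

## References
* S. Adams, S. Buchholz, R. Kotecký, S. Müller, arXiv:1910.13564, Lemma 8.4, Lemma 12.6 [AdamsBuchholzKoteckyMuller2019].
* S. Buchholz, J. Funct. Anal. 275 (2018), Thm 4.5 [Buchholz2016].
-/

noncomputable section

namespace Literature.MathematicalPhysics.StatisticalMechanics.GradientRG

open scoped BigOperators
open Real Finset MeasureTheory
open Literature.MathematicalPhysics.StatisticalMechanics.GradientFRD
  (fourierCoeff IsElliptic IsUnitSymm InShell iterDiff supNorm conv ellOp isElliptic_one exists_inShell)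
open Literature.MathematicalPhysics.StatisticalMechanics.TorusPolymer (IsPolymer numBlocks isPolymer_univ)
open Literature.Barriers.CriticalPhenomena.LongRangePhi4.Polymer (IsConn)
open Literature.MathematicalPhysics.QuantumFieldTheory

variable {d : ℕ}

/-- **`0 ≤ Cℓ ℓ` for `ℓ ≥ 1`** from clause (v) of the package at any height `N ≥ 1`: test the clause at `A = 1`,
`k = 1`, the zero direction `B = 0` and the nonzero mode `κ ≡ 1`. [cite: Buchholz2016, Thm 2.4 (v)] -/
theorem cl_nonneg_of_packageAt (P : PackageData d) {N M : ℕ} [NeZero M] (Q : PackageAt P N M)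
    {ℓ : ℕ} (hℓ : 1 ≤ ℓ) : 0 ≤ P.Cℓ ℓ := by
  have h8 : 8 ≤ 2 ^ (d + 3) := by
    calc 8 = 2 ^ 3 := by norm_num
      _ ≤ 2 ^ (d + 3) := Nat.pow_le_pow_right (by norm_num) (by omega)
  have hL2 : 2 ≤ P.L := by have := P.hL; omega
  have hd1 : 1 ≤ d := by have := P.hd; omega
  have hM2 : 2 ≤ M := by
    rw [Q.hM]
    calc 2 ≤ P.L := hL2
      _ = P.L ^ 1 := (pow_one _).symm
      _ ≤ P.L ^ N := Nat.pow_le_pow_right (by omega) Q.hN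
  haveI : Fact (1 < M) := ⟨by omega⟩
  set κ : Fin d → ZMod M := fun _ => 1 with hκdef
  have hκ : κ ≠ 0 := by
    intro h0
    have h1 := congrFun h0 ⟨0, by omega⟩
    simp [hκdef] at h1
  obtain ⟨j, hj⟩ := exists_inShell hL2 hκ
  have hv := ((Q.hallA 1 isElliptic_one).2.2.2.2.2 1 le_rfl (by omega) j κ hκ hj).2.2 0 isUnitSymm_zero ℓ hℓ
  have hLpos : (0 : ℝ) < (P.L : ℝ) := by exact_mod_cast (show 0 < P.L by omega)
  rcases Nat.lt_or_ge j 1 with hj1 | hj1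
  · have h1 := hv.1 hj1
    have hpos : 0 < (P.L : ℝ) ^ (2 * (d + P.ñ) + 1) * (P.L : ℝ) ^ (2 * j) /
        (P.L : ℝ) ^ ((1 - j) * (d - 1 + P.ñ)) := by positivity
    have h2 : 0 ≤ P.Cℓ ℓ * (P.L : ℝ) ^ (2 * (d + P.ñ) + 1) * (P.L : ℝ) ^ (2 * j) /
        (P.L : ℝ) ^ ((1 - j) * (d - 1 + P.ñ)) := (norm_nonneg _).trans h1
    by_contra hneg
    push Not at hneg
    have : P.Cℓ ℓ * (P.L : ℝ) ^ (2 * (d + P.ñ) + 1) * (P.L : ℝ) ^ (2 * j) /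
        (P.L : ℝ) ^ ((1 - j) * (d - 1 + P.ñ)) < 0 := by
      have e : P.Cℓ ℓ * (P.L : ℝ) ^ (2 * (d + P.ñ) + 1) * (P.L : ℝ) ^ (2 * j) /
          (P.L : ℝ) ^ ((1 - j) * (d - 1 + P.ñ)) =
          P.Cℓ ℓ * ((P.L : ℝ) ^ (2 * (d + P.ñ) + 1) * (P.L : ℝ) ^ (2 * j) /
            (P.L : ℝ) ^ ((1 - j) * (d - 1 + P.ñ))) := by ring
      rw [e]; exact mul_neg_of_neg_of_pos hneg hpos
    linarith
  · have h1 := hv.2 hj1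
    have hpos : 0 < (P.L : ℝ) ^ (2 * 1) := by positivity
    have h2 : 0 ≤ P.Cℓ ℓ * (P.L : ℝ) ^ (2 * 1) := (norm_nonneg _).trans h1
    by_contra hneg
    push Not at hneg
    linarith [mul_neg_of_neg_of_pos hneg hpos]

/-- **The slot `F4Φ22` holds with an explicit `N`-free size** at every height.
[cite: AdamsBuchholzKoteckyMuller2019, Lemma 8.4 / Lemma 12.6 (ℓ = 2, last scale)] -/
theorem f4Φ22_of_packageAt (P : PackageData d) [Fact (0 < P.h)] [Fact (0 < P.L)] {N M : ℕ} [NeZero M]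
    (Q : PackageAt P N M) :
    F4Φ22 P Q
      (4 * (P.A⁻¹ * (P.r₀ + 1) *
        weightIntConstRho P.θbar ((P.θ + P.θbar) / 2)
            (traceConst d P.Mord P.R P.lam (derivSum d P.n fun θ' _ => P.Cα θ' 0)) ^
              (1 / ((1 + (P.θ + P.θbar) / 2) / (1 + P.θ))) *
        (d : ℝ) ^ 4 *
        (108 * Real.conjExponent ((1 + (P.θ + P.θbar) / 2) / (1 + P.θ)) ^ 2 * (3 : ℝ) ^ (d + 1) *
            Real.exp (4 * shellRatioConst P.c (P.Cℓ 1) (P.L : ℝ) d P.ñ) *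
            shellRatioConst P.c (P.Cℓ 1) (P.L : ℝ) d P.ñ ^ 2 +
          8 * Real.conjExponent ((1 + (P.θ + P.θbar) / 2) / (1 + P.θ)) * Real.sqrt ((3 : ℝ) ^ (d + 1)) *
            max (shellRatioConst P.c (P.Cℓ 2) (P.L : ℝ) d P.ñ) 0))) := by
  intro q y z hq hqy hqz hqyz y₀ c hy₀ _hc
  set pH := ((1 + (P.θ + P.θbar) / 2) / (1 + P.θ)) with hpH
  -- Hölder data (N-free)
  set ρ'' := (P.θ + P.θbar) / 2 with hρ''def
  have hρ''0 : 0 ≤ ρ'' := by rw [hρ''def]; linarith [P.hθ0, P.hθ, P.hθbar]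
  have hρ''θ : ρ'' < P.θbar := by rw [hρ''def]; linarith [P.hθ]
  have h1θ : 0 < 1 + P.θ := by linarith [P.hθ0]
  have hp1 : 1 < pH := by
    rw [hpH, one_lt_div h1θ]; linarith [P.hθ]
  have hpq : pH.HolderConjugate (Real.conjExponent pH) := Real.HolderConjugate.conjExponent hp1
  have hpρ : pH * (1 + P.θ) ≤ 1 + ρ'' := by
    rw [hpH, hρ''def, div_mul_cancel₀ _ h1θ.ne']
  have hA : 0 < P.A := by linarith [P.hA1]
  have hC2 : 0 ≤ P.Cℓ 2 := cl_nonneg_of_packageAt P Q (by norm_num)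
  -- data of `y₀`
  have hMo : Odd M := by rw [Q.hM]; exact P.hLodd.pow
  have hy₀W : WeakNormLE Q.normParams N
      (y₀ : Finset (Fin d → ZMod M) → ((Fin d → ZMod M) → ℝ) → ℂ) c := hy₀
  have hMt : M = Q.normParams.L ^ N * P.L ^ 0 := by
    show M = P.L ^ N * P.L ^ 0
    rw [pow_zero, mul_one]; exact Q.hM
  have hc0 : 0 ≤ c := nonneg_of_weakNormLE hA hMt P.hLodd.pow P.hLodd.pow hy₀W
  have hyd : ContDiff ℝ P.r₀ ((y₀ : Finset (Fin d → ZMod M) → ((Fin d → ZMod M) → ℝ) → ℂ) univ) :=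
    activitySpace.contDiff y₀ univ
  have hΛp : IsPolymer (P.L ^ N) (univ : Finset (Fin d → ZMod M)) := isPolymer_univ _
  have hΛc : IsConn (univ : Finset (Fin d → ZMod M)) := isConn_top_univ hMo
  have hyloc : IsGaugeLocal (Q.normParams.gauge N univ)
      ((y₀ : Finset (Fin d → ZMod M) → ((Fin d → ZMod M) → ℝ) → ℂ) univ) :=
    activitySpace.isGaugeLocal y₀ hΛp hΛc
  have hmain := norm_integral_last_kernel_paraSecondDiff_le_of_torusFRD P.hd P.hMord P.hMR P.hLodd P.hL Q.hM
    P.hθbar P.hlam P.hn P.hn2 P.hnñ P.hgap P.hc P.hC1 hC2 Q.hallA Q.hB P.hθ0 P.hθ P.hT₀ P.hKT₀ hq hqy hqz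
    hqyz hpq hρ''0 hρ''θ hpρ hA hc0 hy₀W hyd hyloc (pT := P.pT) (r₀ := P.r₀) (h := P.h)
  refine hmain.trans ?_
  have hA𝒫p : 0 ≤ weightIntConstRho P.θbar ρ''
      (traceConst d P.Mord P.R P.lam (derivSum d P.n fun θ' _ => P.Cα θ' 0)) :=
    zero_le_one.trans (one_le_weightIntConstRho P.hθbar hρ''0 hρ''θ
      (traceConst_nonneg d P.Mord P.R P.hlam.le (derivSum_nonneg d P.n _)))
  have hκ : 0 ≤ weightIntConstRho P.θbar ρ''
      (traceConst d P.Mord P.R P.lam (derivSum d P.n fun θ' _ => P.Cα θ' 0)) ^ (1 / pH) :=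
    Real.rpow_nonneg hA𝒫p _
  have hq0 : 0 ≤ Real.conjExponent pH := by linarith [hpq.symm.lt]
  have hK1 : 0 ≤ shellRatioConst P.c (P.Cℓ 1) (P.L : ℝ) d P.ñ :=
    shellRatioConst_nonneg P.hc P.hC1 (Nat.cast_nonneg _) d P.ñ
  have hAinv : 0 ≤ P.A⁻¹ := inv_nonneg.2 hA.le
  have hmax : shellRatioConst P.c (P.Cℓ 2) (P.L : ℝ) d P.ñ ≤ max (shellRatioConst P.c (P.Cℓ 2) (P.L : ℝ) d P.ñ) 0 :=
    le_max_left _ _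
  have hy0 : 0 ≤ ∑ i, ∑ j, |y i j| := entrySum_nonneg y
  have hz0 : 0 ≤ ∑ i, ∑ j, |z i j| := entrySum_nonneg z
  unfold esum
  gcongr

/-- **The `F4Φ22` half of `L2GaussianCore`**: every package admits an `N`-free size for the slot F4Φ22.
[cite: AdamsBuchholzKoteckyMuller2019, Lemma 8.4 / Lemma 12.6 (ℓ = 2, last scale)] -/
theorem exists_f4Φ22_unif (P : PackageData d) [Fact (0 < P.h)] [Fact (0 < P.L)] :
    ∃ φTT : ℝ, 0 ≤ φTT ∧ ∀ (N M : ℕ) [NeZero M] (Q : PackageAt P N M), F4Φ22 P Q φTT := by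
  refine ⟨(4 * (P.A⁻¹ * (P.r₀ + 1) *
        weightIntConstRho P.θbar ((P.θ + P.θbar) / 2)
            (traceConst d P.Mord P.R P.lam (derivSum d P.n fun θ' _ => P.Cα θ' 0)) ^
              (1 / ((1 + (P.θ + P.θbar) / 2) / (1 + P.θ))) *
        (d : ℝ) ^ 4 *
        (108 * Real.conjExponent ((1 + (P.θ + P.θbar) / 2) / (1 + P.θ)) ^ 2 * (3 : ℝ) ^ (d + 1) *
            Real.exp (4 * shellRatioConst P.c (P.Cℓ 1) (P.L : ℝ) d P.ñ) *
            shellRatioConst P.c (P.Cℓ 1) (P.L : ℝ) d P.ñ ^ 2 +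
          8 * Real.conjExponent ((1 + (P.θ + P.θbar) / 2) / (1 + P.θ)) * Real.sqrt ((3 : ℝ) ^ (d + 1)) *
            max (shellRatioConst P.c (P.Cℓ 2) (P.L : ℝ) d P.ñ) 0))), ?_, fun N M _ Q => f4Φ22_of_packageAt P Q⟩
  set pH := ((1 + (P.θ + P.θbar) / 2) / (1 + P.θ)) with hpH
  have hA : 0 < P.A := by linarith [P.hA1]
  have hρ''0 : 0 ≤ (P.θ + P.θbar) / 2 := by linarith [P.hθ0, P.hθ, P.hθbar]
  have hρ''θ : (P.θ + P.θbar) / 2 < P.θbar := by linarith [P.hθ]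
  have hA𝒫p : 0 ≤ weightIntConstRho P.θbar ((P.θ + P.θbar) / 2)
      (traceConst d P.Mord P.R P.lam (derivSum d P.n fun θ' _ => P.Cα θ' 0)) :=
    zero_le_one.trans (one_le_weightIntConstRho P.hθbar hρ''0 hρ''θ
      (traceConst_nonneg d P.Mord P.R P.hlam.le (derivSum_nonneg d P.n _)))
  have h1θ : 0 < 1 + P.θ := by linarith [P.hθ0]
  have hp1 : 1 < pH := by
    rw [hpH, one_lt_div h1θ]; linarith [P.hθ]
  have hq0 : 0 ≤ Real.conjExponent pH := by
    have := (Real.HolderConjugate.conjExponent hp1).symm.lt; linarith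
  have hK1 : 0 ≤ shellRatioConst P.c (P.Cℓ 1) (P.L : ℝ) d P.ñ :=
    shellRatioConst_nonneg P.hc P.hC1 (Nat.cast_nonneg _) d P.ñ
  have hκ : 0 ≤ weightIntConstRho P.θbar ((P.θ + P.θbar) / 2)
      (traceConst d P.Mord P.R P.lam (derivSum d P.n fun θ' _ => P.Cα θ' 0)) ^ (1 / pH) :=
    Real.rpow_nonneg hA𝒫p _
  have hAinv : 0 ≤ P.A⁻¹ := inv_nonneg.2 hA.le
  have hmax : 0 ≤ max (shellRatioConst P.c (P.Cℓ 2) (P.L : ℝ) d P.ñ) 0 := le_max_right _ _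
  positivity

end Literature.MathematicalPhysics.StatisticalMechanics.GradientRG

end
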